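/-
Copyright: statement-level skeleton of a published paper (lit-balaban cell, Phase-2 proof seat p26, gen 35). No claims beyond
what the kernel checks below.
-/
import Mathlib
import Literature.MathematicalPhysics.QuantumFieldTheory.Balaban1983to89.B3Eq332Pictures
import Literature.MathematicalPhysics.QuantumFieldTheory.Balaban1983to89.B3Sect2ThreeLegGraphs
import Literature.MathematicalPhysics.QuantumFieldTheory.Balaban1983to89.B3Sect3TriangleGraphs

/-!
# B3 — T. Bałaban, *(Higgs)₂,₃ quantum fields in a finite volume. III. Renormalization*, Commun. Math. Phys. **88** (1983)
411–445 [Balaban1983Higgs3] — p. 443 [PDF 33]: **the picture equation (3.35)** (the transport of the legs of the triangle graphs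
(2.20) *"within the indicated ordering"*, with the integration by parts (2.9) at the vertex left without external legs) AS DRAWN
OBJECTS, their count data derived, and the dictionary to r15's (3.33) `B3Sect3TriangleGraphs.expr333`

statement-level skeleton of published theorems with citation tags; proofs where landed; nothing here is a claim about the
Yang–Mills mass gap

PDF held: `paper:balaban1983-higgs-2-3-quantum-fields-finite-volume` (journal page = PDF page + 410).  The display (3.35) is a
picture equation of three printed rows (nine pictures); it was READ AS AN IMAGE on the ×2 render
`run/shared/lean/pub/pub-balaban/b2b-balaban-ref1/pages/1983-cmp88-higgs23-III/1983-cmp88-higgs23-III-p033-x2.png` (strip crops at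
full resolution, seat folder `scratch/r1a,r1b,r2a,r2b,r3.png`), together with (2.20) p. 429 (`…-p019-x2.png`) and the notations (2.9)
p. 425 (`…-p015-x2.png`); never the OCR layer (which drops the display entirely).

CITATION HEADER (lean-in-tree rule).  lit-balaban MEGA-FORMALIZATION (HOME `run/shared/lean/pub/lit-balaban/`), Phase 2, seat
**p26 gen 35** (unit `lit-balaban-p26-g35`), free-target protocol G.5-34(d): the target named by the fold owner r15 for row
**B3.Eq3.33-3.38** of `HOME/lit-balaban-r15/ROWS-B3.md`, residual **(b)** *"(3.35) p. 443 — the 2 + 2 + [·] pictures for the graphs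
(2.20) «within the indicated ordering» as drawn objects (numbered legs 1–6, ±α labels on legs, ✱ vertices, arrowheads, print's +
signs and the square bracket); dictionary LHS ↦ `B3Sect3TriangleGraphs.expr333`"* (r15 → p26, seat INBOX 2026-08-23T03:17:28Z; TAKING
HOME/STATUS.md 03:37:24Z).  Format of the sibling picture files `B3Eq37Pictures` (p26 g10: `LocPicture`, `legDiffs`, `LineEnum`,
`countsOf`, `LocPicture.amp`), `B3Eq332Pictures` (p37 g79: `HolderPicture`), `B3Eq317Pictures` (p26 g35).

THE PRINTED TEXT (verbatim, p. 443 [PDF 33]).  After (3.34): *"A more detailed inspection of the divergent graphs shows that we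
can transport the legs in such a way that the subgraphs (2.4) either are made convergent by a factor of the form |x₁ − x₂|^α, or
the formula for integration by parts can be applied without differentiations acting on external legs. For example for the
graphs (2.20) we have within the indicated ordering: [(3.35)]  This way all the expressions on the right side of (3.34) are
convergent, except the first two."*  THE DISPLAY (3.35), read on the render (legend (1.17) p. 415: straight = φ′, wavy = vector,
small circle = vertex (1.8), arrowhead adjacent to a vertex on a φ′-leg = the differentiation of that vertex; the notations ✱ of
(2.9) p. 425).  Every picture is the triangle (2.20): a top vertex T (circle) with the external wavy leg **6** going up, joined by
the straight line **1** (left) to the bottom-left vertex BL and by the straight line **2** (right) to the bottom-right vertex BR;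
BL and BR joined by the wavy line **3**; the external straight legs **4** (at BL, to the left) and **5** (at BR, to the right).
Row 1: `[a] + [b] = [R1] + [R2]`, where **a**: arrowheads on line 1 at T and at BL, on line 2 at BR; **b**: arrowheads on line 2
at T and at BR, on line 1 at BL (the two printed members of the pair (2.20) p. 429); **R1**, **R2**: the same two graphs with the
legs 4 and 5 drawn through the top vertex T (all three external legs at T).  Rows 2–3: `+ [ B1 + B2 + B3 + (row 3) + B4 + B5 ]`
(one square bracket, opened before B1 and closed after B5, the equation number (3.35) after it), where **B1** = a and **B2** = b
each with the label "+α" written at line 1 and the label "−α" at leg 4, whose arrowhead points outward (leg 5 plain, at BR);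
**B3** = a with leg 4 drawn through T, NO arrowhead at BL on line 1, the sign ✱ at BL next to the wavy line 3 which carries an
arrowhead near BL, "+α" at line 2, "−α" at leg 5 (arrowhead outward); **B4** = the same as B3 but line 3 without arrowhead (✱ at
BL); **B5** = b with leg 4 drawn through T, "+α" at line 2, "−α" at leg 5 (arrowhead outward), all other arrowheads of b kept.
All printed signs are "+".  r15's offer counted "2 + 2 + [7]"; the render shows 2 + 2 + [5] (three pictures in row 2, two in
row 3) ⟦sic: count⟧ — recorded, not adjudicated.

THE READING (stated, not silently substituted; every clause below is either a `def` with body or a kernel-checked lemma).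
(i) "the indicated ordering" = the printed numbering: internal lines 1 < 2 < 3, external legs 4 < 5 < 6; p. 443: *"we transport
the legs with the lowest j-indices to a vertex having a leg with highest index"* — legs 4 and 5 go to T, the vertex of leg 6.
(ii) ±α (p. 442 (3.32), p37's `HolderPicture`): "−α" on an external leg = the difference quotient of order α of its field
relative to the vertex it is transported to (T), "+α" on a line = the compensating weight |x_T − x_v|^α, v the leg's own vertex —
the line joining T and v (line 1 for leg 4, line 2 for leg 5: `plusLine_B12`, `plusLine_B345`).  (iii) ✱ (p. 425 (2.9), *"here we
have defined the new graphical notations"*): the integration by parts (2.8) at a vertex (1.8) moves its differentiation off its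
φ′-line onto (✱→) its A′-leg, (✱) its localization function, or (third notation) its other φ′-leg; in B3/B4 the third term is
absent because the other φ′-leg of BL is leg 4, already transported to T (*"without differentiations acting on external legs"*,
`no_third_term_B34`).  (iv) graph a needs (2.9) and graph b does not: along the ordering the first subgraph G₁ = {line 1} of a is
the graph (2.4) (both endpoint differentiations on the line, `pattern220a`), that of b is not (`pattern220b`); in B1 the weight
sits on line 1 itself, in the leg-5 terms of a it sits on line 2, whence (2.9) at BL (`picB34pre`, the undrawn intermediate
term «a with leg 4 at T, leg 5 decorated, before (2.9)», is recorded as such and named so).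

WHAT THIS MODULE CONTAINS (sorry-free; no `Prop` fact introduced; every `def` has a body).
§1 DRAWN OBJECTS: the vertex kinds `kind220` and the graph a = p18's `B3Sect2ThreeLegGraphs.g220` in closed form (`other220a`,
`g220_other`), the second printed member b (`g220b`, `other220b`; p18 typed one member of the pair), the legs `sT`, `sBL`, `sBR`,
`wBL`, `wBR` (`leg4`, `leg5`), the lines DECIDED (`lines220a/b`, `ext220_iff`); the nine pictures `picA`, `picB` (natural),
`picR1`, `picR2` (legs 4, 5 at T: `locT`), `picB1`, `picB2`, `picB5`, the intermediate `picB34pre` (p37's `HolderPicture`), and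
the ✱-pictures `picB3`, `picB4` : `StarPicture` (= a `HolderPicture` + the starred vertex + the target of (2.9)); the equation
record `pic335 : PicEq335` with print's signs.  §2 COUNT DATA DERIVED, never typed in: D = 0 in d = 3 for a (p18) and b
(`deg_g220b`); the line enumerations in the printed order (`enum220a/b`, kinds and endpoints decided, p19's count datum
`countsOf` available); the differentiation pattern of every line (`pattern220a/b`: line 1 of a carries both endpoint
differentiations = the (2.4) pattern, no line of b along G₁ does); the arrows after ✱ (`StarPicture.arrow`, `arrows_B3`,
`arrows_B4`); the (2.4)-block {T, BL, line 1} of a has degree 0 and degree 1 after (2.9) (`deg_block1_a`, `deg_block1_star`, r15's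
`graphDegree`, p. 425 *"replaced by the graphs with degree +1"*); the decorated pictures have degree α (`deg_B`).  §3 DICTIONARY
(torus T^{(j)}_η of r15): `amp3` (the expression of a three-vertex picture with the vector leg at T and the two scalar legs at
their localization vertices), `ampH3L`/`ampH3R` (Hölder-decorated left/right scalar leg, `holderLeg`); **LHS ↦ (3.33)**:
`amp3_picA`, `amp3_picB` (= `expr333 η Γ` for the kernel of the graph), `lhs335_eq_expr333`; **R1/R2 ↦ the local term at T**
(`local335`, `amp3_picR1`, `amp3_picR2`); the transport identity at T PROVED for every kernel (`eq335_transport_a`/`_b`: (3.33) =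
[leg-4 term] + [leg-5 remainder] + [local term], the algebra of r15's `eq334` with the legs sent to the vector vertex instead of the
φ′ vertex); **(2.9) at BL PROVED** on the torus for a kernel with the (1.8) structure at BL — a lattice derivative on the line-1 end
times g₁(x′) times the line-3 end (`kerBL`; the ✱-kernels `kerStarVec`, `kerStarLoc`) — by summation by parts and the Leibniz rule
(`sum_kerBL`; `ampH3R_B34pre`, `ibp_BL`: [intermediate term] = [B3-term] + [B4-term], the third notation absent); the assembled
(3.35) (`eq335`).  NOT HERE: the analytic claim "convergent" ((2.14)/Prop. 2.2 for generalized graphs: p20's `B3TriangleAlphaGain`, p18's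
`B3Eq320PositiveSubgraphs`, cited by name), the kernels of (2.20) as products of propagators (r15 keeps Γ abstract in (3.33); so
does this file), the ηℤ³ twin (r15: not needed for a picture dictionary).
-/

open Finset

namespace Literature.MathematicalPhysics.QuantumFieldTheory.Balaban1983to89.B3Eq335Pictures

/-! ## 1. The drawn objects of (3.35) -/

section Pictures

open B3Prop1 B3Cor23Concrete B3Sect2ThreeLegGraphs B3Eq37Pictures B3Eq332Pictures

variable {nbar : ℕ} (hn : 1 ≤ nbar)

/-! ### The triangle (2.20): vertices, legs, lines (p18's `g220` in closed form, and the second printed member) -/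

/-- the φ′-leg `j` of the top vertex T = `0` ((1.8)_{0,1}; `j = 0` the differentiated one). [cite: Balaban1983Higgs3, (2.20) p.429] -/
def sT (j : Fin 2) : Leg kind220 := ⟨0, .inl (j.cast (by decide))⟩

/-- the φ′-leg `j` of the bottom-left vertex BL = `1` ((1.8)_{1,0}; `j = 0` differentiated, `j = 1` = the external leg 4).
[cite: Balaban1983Higgs3, (2.20) p.429] -/
def sBL (j : Fin 2) : Leg kind220 := ⟨1, .inl (j.cast (by decide))⟩

/-- the φ′-leg `j` of the bottom-right vertex BR = `2` ((1.8)_{1,0}; `j = 0` differentiated, `j = 1` = the external leg 5).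
[cite: Balaban1983Higgs3, (2.20) p.429] -/
def sBR (j : Fin 2) : Leg kind220 := ⟨2, .inl (j.cast (by decide))⟩

/-- the A′-leg of BL (an end of the wavy line 3). [cite: Balaban1983Higgs3, (2.20) p.429] -/
def wBL : Leg kind220 := ⟨1, .inr ⟨0, by decide⟩⟩

/-- the A′-leg of BR (the other end of the wavy line 3). [cite: Balaban1983Higgs3, (2.20) p.429] -/
def wBR : Leg kind220 := ⟨2, .inr ⟨0, by decide⟩⟩

/-- the external leg **4** of (3.35) (φ′ at BL). [cite: Balaban1983Higgs3, (3.35) p.443] -/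
abbrev leg4 : Leg kind220 := sBL 1

/-- the external leg **5** of (3.35) (φ″ at BR). [cite: Balaban1983Higgs3, (3.35) p.443] -/
abbrev leg5 : Leg kind220 := sBR 1

/-- **The lines of the graph a** (p18's `g220.other`, verbatim, in closed form): line 1 joins the DIFFERENTIATED leg of T to the
differentiated leg of BL, line 2 the plain leg of T to the differentiated leg of BR, line 3 the two A′-legs; legs 4, 5 external;
T has no A′-leg (its vector leg 6 is the Ã-leg of (1.8)_{0,1}). [cite: Balaban1983Higgs3, (2.20) p.429] -/
def other220a : Leg kind220 → Option (Leg kind220)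
  | ⟨0, .inl j⟩ => if j.val = 0 then some (sBL 0) else some (sBR 0)
  | ⟨1, .inl j⟩ => if j.val = 0 then some (sT 0) else none
  | ⟨2, .inl j⟩ => if j.val = 0 then some (sT 1) else none
  | ⟨0, .inr j⟩ => j.elim0
  | ⟨1, .inr _⟩ => some wBR
  | ⟨2, .inr _⟩ => some wBL

/-- **The lines of the graph b** (the second printed member of the pair (2.20), the mirror placement of the differentiation of T):
line 2 joins the DIFFERENTIATED leg of T to the differentiated leg of BR, line 1 the plain leg of T to the differentiated leg of BL.
[cite: Balaban1983Higgs3, (2.20) p.429] -/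
def other220b : Leg kind220 → Option (Leg kind220)
  | ⟨0, .inl j⟩ => if j.val = 0 then some (sBR 0) else some (sBL 0)
  | ⟨1, .inl j⟩ => if j.val = 0 then some (sT 1) else none
  | ⟨2, .inl j⟩ => if j.val = 0 then some (sT 0) else none
  | ⟨0, .inr j⟩ => j.elim0
  | ⟨1, .inr _⟩ => some wBR
  | ⟨2, .inr _⟩ => some wBL

/-- p18's `g220` IS the graph a: its pairing is `other220a` (definitionally). [cite: Balaban1983Higgs3, (2.20) p.429] -/
theorem g220_other : ∀ x : Leg kind220, (g220 nbar hn).other x = other220a x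
  | ⟨0, .inl _⟩ => rfl
  | ⟨1, .inl _⟩ => rfl
  | ⟨2, .inl _⟩ => rfl
  | ⟨0, .inr j⟩ => j.elim0
  | ⟨1, .inr _⟩ => rfl
  | ⟨2, .inr _⟩ => rfl

/-- p18's `g220` has the vertices `kind220`, three of them. [cite: Balaban1983Higgs3, (2.20) p.429] -/
theorem g220_kind_nV : (g220 nbar hn).kind = kind220 ∧ (g220 nbar hn).nV = 3 := ⟨rfl, rfl⟩

/-- **The graph b of (2.20)/(3.35)** as a graph of p18's model (the same three vertices, the pairing `other220b`).
[cite: Balaban1983Higgs3, (2.20) p.429] -/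
def g220b (nbar : ℕ) (hn : 1 ≤ nbar) : Graph nbar where
  nV := 3
  kind := kind220
  adm i := by fin_cases i <;> simp [kind220, VertexKind.Admissible, hn]
  other := other220b
  other_ne := by decide
  other_symm := by decide
  other_isLeft := by decide
  exists_line := by decide

/-- `g220b` has the pairing `other220b` (definitionally). [cite: Balaban1983Higgs3, (2.20) p.429] -/
theorem g220b_other (x : Leg kind220) : (g220b nbar hn).other x = other220b x := rfl

/-- **The lines of a, DECIDED**: line 1 = (sT 0, sBL 0) — both endpoint legs are the differentiated ones —, line 2 = (sT 1, sBR 0),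
line 3 = (wBL, wBR); legs 4 and 5 external. [cite: Balaban1983Higgs3, (3.35) p.443] -/
theorem lines220a : other220a (sT 0) = some (sBL 0) ∧ other220a (sT 1) = some (sBR 0) ∧ other220a wBL = some wBR ∧
    other220a leg4 = none ∧ other220a leg5 = none := by decide

/-- **The lines of b, DECIDED**: line 1 = (sT 1, sBL 0), line 2 = (sT 0, sBR 0) — both endpoint legs differentiated —, line 3 =
(wBL, wBR); legs 4 and 5 external. [cite: Balaban1983Higgs3, (3.35) p.443] -/
theorem lines220b : other220b (sT 1) = some (sBL 0) ∧ other220b (sT 0) = some (sBR 0) ∧ other220b wBL = some wBR ∧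
    other220b leg4 = none ∧ other220b leg5 = none := by decide

/-- In both graphs exactly the legs 4 and 5 are external (leg 6 is the Ã-leg of T, not a leg of the model).
[cite: Balaban1983Higgs3, (3.35) p.443] -/
theorem ext220_iff : ∀ x : Leg kind220, (other220a x = none ↔ x = leg4 ∨ x = leg5) ∧ (other220b x = none ↔ x = leg4 ∨ x = leg5) := by
  decide

/-- The vertex T carries the external vector leg 6: it is of the kind (1.8)_{0,1} (no A′-leg, one Ã-leg); BL and BR are
(1.8)_{1,0}. [cite: Balaban1983Higgs3, (2.20) p.429] -/
theorem kind220_legs : (kind220 0).vectorLegs = 0 ∧ (kind220 0).extVectorLegs = 1 ∧ (kind220 1).vectorLegs = 1 ∧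
    (kind220 1).extVectorLegs = 0 ∧ (kind220 2).vectorLegs = 1 ∧ (kind220 2).extVectorLegs = 0 := by decide

/-! ### The nine pictures -/

/-- **a** = the first picture of (3.35) (LHS₁): the graph a, every leg at its own vertex. [cite: Balaban1983Higgs3, (3.35) p.443] -/
def picA (hn : 1 ≤ nbar) : LocPicture nbar := LocPicture.natural (g220 nbar hn)

/-- **b** = the second picture of (3.35) (LHS₂): the graph b, natural localization. [cite: Balaban1983Higgs3, (3.35) p.443] -/
def picB (hn : 1 ≤ nbar) : LocPicture nbar := LocPicture.natural (g220b nbar hn)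

/-- The localization "legs 4 and 5 at T": the external legs go to the vertex `0`, internal legs stay.
[cite: Balaban1983Higgs3, (3.35) p.443] -/
def locT : Leg kind220 → Fin 3 := fun x => if x = leg4 ∨ x = leg5 then 0 else x.1

/-- The localization "leg 4 at T" (leg 5 still at BR): the intermediate stage of the transport along the ordering.
[cite: Balaban1983Higgs3, (3.35) p.443] -/
def loc4T : Leg kind220 → Fin 3 := fun x => if x = leg4 then 0 else x.1

/-- kernel: both localizations move external legs only. [cite: Balaban1983Higgs3, p.417] -/
theorem locT_int : ∀ x : Leg kind220, ((other220a x).isSome → locT x = x.1) ∧ ((other220b x).isSome → locT x = x.1) ∧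
    ((other220a x).isSome → loc4T x = x.1) ∧ ((other220b x).isSome → loc4T x = x.1) := by decide

/-- **R1** = the third picture of (3.35) (RHS₁): the graph a with the legs 4 and 5 drawn through T.
[cite: Balaban1983Higgs3, (3.35) p.443] -/
def picR1 (hn : 1 ≤ nbar) : LocPicture nbar where
  G := g220 nbar hn
  loc := locT
  loc_int x hx := (locT_int x).1 (by rw [← g220_other hn x]; exact hx)

/-- **R2** = the fourth picture of (3.35) (RHS₂): the graph b with the legs 4 and 5 drawn through T.
[cite: Balaban1983Higgs3, (3.35) p.443] -/
def picR2 (hn : 1 ≤ nbar) : LocPicture nbar where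
  G := g220b nbar hn
  loc := locT
  loc_int x hx := (locT_int x).2.1 hx

/-- a with leg 4 (only) drawn through T — the underlying localized picture of B3, B4 and of the intermediate term.
[cite: Balaban1983Higgs3, (3.35) p.443] -/
def picA4T (hn : 1 ≤ nbar) : LocPicture nbar where
  G := g220 nbar hn
  loc := loc4T
  loc_int x hx := (locT_int x).2.2.1 (by rw [← g220_other hn x]; exact hx)

/-- b with leg 4 (only) drawn through T — the underlying localized picture of B5. [cite: Balaban1983Higgs3, (3.35) p.443] -/
def picB4T (hn : 1 ≤ nbar) : LocPicture nbar where
  G := g220b nbar hn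
  loc := loc4T
  loc_int x hx := (locT_int x).2.2.2 hx

/-- **B1** = the first bracket picture: a with "+α" at line 1 and "−α" at leg 4 (the quotient relative to T).
[cite: Balaban1983Higgs3, (3.35) p.443] -/
def picB1 (hn : 1 ≤ nbar) (α : ℝ) : HolderPicture nbar where
  toLocPicture := picA hn
  α := α
  wleg := leg4
  base := (0 : Fin 3)
  wleg_ext := (g220_other hn leg4).trans lines220a.2.2.2.1

/-- **B2** = the second bracket picture: b with "+α" at line 1 and "−α" at leg 4. [cite: Balaban1983Higgs3, (3.35) p.443] -/
def picB2 (hn : 1 ≤ nbar) (α : ℝ) : HolderPicture nbar where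
  toLocPicture := picB hn
  α := α
  wleg := leg4
  base := (0 : Fin 3)
  wleg_ext := lines220b.2.2.2.1

/-- **B5** = the last bracket picture: b with leg 4 at T, "+α" at line 2 and "−α" at leg 5. [cite: Balaban1983Higgs3, (3.35) p.443] -/
def picB5 (hn : 1 ≤ nbar) (α : ℝ) : HolderPicture nbar where
  toLocPicture := picB4T hn
  α := α
  wleg := leg5
  base := (0 : Fin 3)
  wleg_ext := lines220b.2.2.2.2

/-- The intermediate term of a NOT printed in (3.35): a with leg 4 at T, "+α" at line 2, "−α" at leg 5, BEFORE the integration by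
parts at BL (its first subgraph {line 1} is still the graph (2.4)); (3.35) prints its two (2.9)-descendants B3, B4 instead.
[cite: Balaban1983Higgs3, (3.35) p.443] -/
def picB34pre (hn : 1 ≤ nbar) (α : ℝ) : HolderPicture nbar where
  toLocPicture := picA4T hn
  α := α
  wleg := leg5
  base := (0 : Fin 3)
  wleg_ext := (g220_other hn leg5).trans lines220a.2.2.2.2

/-- Where the integration by parts (2.9) sends the differentiation of the starred vertex: onto its A′-leg (print: ✱ with an
arrowhead on the wavy leg) or onto its localization function (print: ✱ alone).  The third notation of (2.9) (onto the other
φ′-leg) does not occur in (3.35). [cite: Balaban1983Higgs3, (2.9) p.425] -/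
inductive IBPTarget
  | vectorLeg
  | locFn
  deriving DecidableEq

/-- **A ✱-picture** (the notations (2.9) p. 425 inside a decorated picture): a Hölder-decorated picture one of whose vertices is
marked ✱ — the integration by parts (2.8) has been applied there — together with the target of the moved differentiation.
[cite: Balaban1983Higgs3, (2.9) p.425] -/
structure StarPicture (nbar : ℕ) extends HolderPicture nbar where
  /-- the starred vertex -/
  star : Fin G.nV
  /-- where its differentiation went -/
  target : IBPTarget

/-- **B3** = the third bracket picture: a with leg 4 at T, ✱ at BL with the arrowhead on the wavy line 3, "+α" at line 2, "−α"
at leg 5. [cite: Balaban1983Higgs3, (3.35) p.443] -/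
def picB3 (hn : 1 ≤ nbar) (α : ℝ) : StarPicture nbar where
  toHolderPicture := picB34pre hn α
  star := (1 : Fin 3)
  target := .vectorLeg

/-- **B4** = the fourth bracket picture: as B3 but ✱ alone at BL (the differentiation on the localization function of BL).
[cite: Balaban1983Higgs3, (3.35) p.443] -/
def picB4 (hn : 1 ≤ nbar) (α : ℝ) : StarPicture nbar where
  toHolderPicture := picB34pre hn α
  star := (1 : Fin 3)
  target := .locFn

/-- A picture equation [a] + [b] = [R1] + [R2] + [B1 + B2 + B3 + B4 + B5] as printed in (3.35): the drawn objects in order with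
print's signs (the model has no algebra of pictures). [cite: Balaban1983Higgs3, (3.35) p.443] -/
structure PicEq335 (nbar : ℕ) where
  /-- the left side, signed -/
  lhs : List (ℤ × LocPicture nbar)
  /-- the two local pictures of the right side, signed -/
  local335 : List (ℤ × LocPicture nbar)
  /-- the bracket: its decorated pictures without ✱ in print order B1, B2, B5, signed -/
  holder : List (ℤ × HolderPicture nbar)
  /-- the bracket: its ✱-pictures B3, B4, signed -/
  starred : List (ℤ × StarPicture nbar)

/-- **(3.35)** p. 443 [PDF 33]: the nine pictures with the printed signs (all "+"). [cite: Balaban1983Higgs3, (3.35) p.443] -/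
def pic335 (hn : 1 ≤ nbar) (α : ℝ) : PicEq335 nbar where
  lhs := [(1, picA hn), (1, picB hn)]
  local335 := [(1, picR1 hn), (1, picR2 hn)]
  holder := [(1, picB1 hn α), (1, picB2 hn α), (1, picB5 hn α)]
  starred := [(1, picB3 hn α), (1, picB4 hn α)]

/-- print's signs: every picture of (3.35) enters with "+". [cite: Balaban1983Higgs3, (3.35) p.443] -/
theorem pic335_signs (α : ℝ) : ((pic335 hn α).lhs.map Prod.fst = [1, 1]) ∧ ((pic335 hn α).local335.map Prod.fst = [1, 1]) ∧
    ((pic335 hn α).holder.map Prod.fst = [1, 1, 1]) ∧ ((pic335 hn α).starred.map Prod.fst = [1, 1]) := ⟨rfl, rfl, rfl, rfl⟩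

/-! ### What the drawings show, derived -/

/-- a and b: every leg at its own vertex; R1, R2: legs 4 and 5 at T (`0`), the internal legs in place.
[cite: Balaban1983Higgs3, (3.35) p.443] -/
theorem loc_pics : (∀ x, (picA hn).loc x = x.1 ∧ (picB hn).loc x = x.1 ∧ (picR1 hn).loc x = locT x ∧ (picR2 hn).loc x = locT x) ∧
    locT leg4 = 0 ∧ locT leg5 = 0 ∧ leg4.1 = (1 : Fin 3) ∧ leg5.1 = (2 : Fin 3) := by
  refine ⟨fun x => ⟨rfl, rfl, rfl, rfl⟩, ?_⟩
  decide

/-- B3, B4, B5 and the intermediate term: leg 4 at T, leg 5 at its own vertex BR. [cite: Balaban1983Higgs3, (3.35) p.443] -/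
theorem loc4T_legs : loc4T leg4 = 0 ∧ loc4T leg5 = 2 ∧ (∀ x, (picA4T hn).loc x = loc4T x ∧ (picB4T hn).loc x = loc4T x) := by
  refine ⟨by decide, by decide, fun x => ⟨rfl, rfl⟩⟩

/-- The decorations, read back: B1, B2 decorate leg 4, B5 and B3/B4 (and the intermediate term) decorate leg 5, all relative to T,
all with the exponent α. [cite: Balaban1983Higgs3, (3.35) p.443] -/
theorem holder_data (α : ℝ) : ((picB1 hn α).wleg = leg4 ∧ (picB1 hn α).base = (0 : Fin 3) ∧ (picB1 hn α).α = α) ∧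
    ((picB2 hn α).wleg = leg4 ∧ (picB2 hn α).base = (0 : Fin 3) ∧ (picB2 hn α).α = α) ∧
    ((picB5 hn α).wleg = leg5 ∧ (picB5 hn α).base = (0 : Fin 3) ∧ (picB5 hn α).α = α) ∧
    ((picB3 hn α).wleg = leg5 ∧ (picB3 hn α).base = (0 : Fin 3) ∧ (picB3 hn α).star = (1 : Fin 3) ∧
      (picB3 hn α).target = IBPTarget.vectorLeg) ∧
    ((picB4 hn α).wleg = leg5 ∧ (picB4 hn α).base = (0 : Fin 3) ∧ (picB4 hn α).star = (1 : Fin 3) ∧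
      (picB4 hn α).target = IBPTarget.locFn) :=
  ⟨⟨rfl, rfl, rfl⟩, ⟨rfl, rfl, rfl⟩, ⟨rfl, rfl, rfl⟩, ⟨rfl, rfl, rfl, rfl⟩, ⟨rfl, rfl, rfl, rfl⟩⟩

/-- **"+α" sits on line 1 in B1 and B2**: the weight joins the base T = `0` and the decorated leg's vertex BL = `1`, and line 1 is
the line between these two vertices (a: (sT 0, sBL 0); b: (sT 1, sBL 0)). [cite: Balaban1983Higgs3, (3.35) p.443] -/
theorem plusLine_B12 (α : ℝ) : (picB1 hn α).base = (0 : Fin 3) ∧ (picB1 hn α).wleg.1 = (1 : Fin 3) ∧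
    other220a (sT 0) = some (sBL 0) ∧
    (picB2 hn α).base = (0 : Fin 3) ∧ (picB2 hn α).wleg.1 = (1 : Fin 3) ∧ other220b (sT 1) = some (sBL 0) :=
  ⟨rfl, rfl, lines220a.1, rfl, rfl, lines220b.1⟩

/-- **"+α" sits on line 2 in B3, B4, B5**: base T = `0`, decorated leg 5 at BR = `2`, and line 2 joins T and BR.
[cite: Balaban1983Higgs3, (3.35) p.443] -/
theorem plusLine_B345 (α : ℝ) : (picB3 hn α).base = (0 : Fin 3) ∧ (picB3 hn α).wleg.1 = (2 : Fin 3) ∧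
    other220a (sT 1) = some (sBR 0) ∧
    (picB5 hn α).base = (0 : Fin 3) ∧ (picB5 hn α).wleg.1 = (2 : Fin 3) ∧ other220b (sT 0) = some (sBR 0) :=
  ⟨rfl, rfl, lines220a.2.1, rfl, rfl, lines220b.2.1⟩

/-- **(2.9)'s third notation is absent in (3.35)**: the other φ′-leg of the starred vertex BL is leg 4, and in B3/B4 its field sits
at T ≠ BL — *"without differentiations acting on external legs"*. [cite: Balaban1983Higgs3, (3.35) p.443] -/
theorem no_third_term_B34 (α : ℝ) : (picB3 hn α).star = leg4.1 ∧ (picB3 hn α).loc leg4 = (0 : Fin 3) ∧ (0 : Fin 3) ≠ leg4.1 ∧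
    (picB4 hn α).star = leg4.1 ∧ (picB4 hn α).loc leg4 = (0 : Fin 3) := by
  refine ⟨rfl, ?_, by decide, rfl, ?_⟩ <;> exact (loc4T_legs hn).1

end Pictures

/-! ## 2. The count data of the pictures, derived (never typed in) -/

section Counting

open B3Prop1 B3Cor23Concrete B3Sect2ThreeLegGraphs B3Eq37Pictures B3Eq332Pictures B3Sect2Statements B3VertexBridge
open B3DivergentGraphs B3Sect3DegreeCensus

variable {nbar : ℕ} (hn : 1 ≤ nbar)

/-! ### D = 0 in d = 3 (p. 443: *"and the degree is 0"*) -/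

/-- **a has D = 0 in d = 3** (p18's `threeLeg_deg` route: no vertex (1.13)–(1.15), budget 6). [cite: Balaban1983Higgs3, (3.33) p.443] -/
theorem deg_g220a : (g220 nbar hn).deg 3 = 0 :=
  deg_three_eq_zero_of_budget _ (by rintro ⟨i, hi⟩; fin_cases i <;> simp [g220, kind220, VertexKind.isOfForm1315] at hi) (by rfl)

/-- **b has D = 0 in d = 3** (same route). [cite: Balaban1983Higgs3, (3.33) p.443] -/
theorem deg_g220b : (g220b nbar hn).deg 3 = 0 :=
  deg_three_eq_zero_of_budget _ (by rintro ⟨i, hi⟩; fin_cases i <;> simp [g220b, kind220, VertexKind.isOfForm1315] at hi) (by rfl)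

/-- b is in the class «two external scalar legs, one external vector leg» exactly as a (p18's `threeLeg_legs` for a): two external
φ′-legs, no external A′-leg, one Ã-leg, no differentiation on an external leg. [cite: Balaban1983Higgs3, (2.20) p.429] -/
theorem legs_g220b : numExtScalarLegs (g220b nbar hn) = 2 ∧ numExtVectorLegs (g220b nbar hn) = 0 ∧
    numTildeLegs (g220b nbar hn) = 1 ∧ numExtDiffs (g220b nbar hn) = 0 := ⟨by rfl, by rfl, by rfl, by rfl⟩

/-- **"made convergent by a factor |x₁ − x₂|^α"**: the decorated pictures B1, B2, B5 and the intermediate term have degree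
D + α = α in d = 3 (p37's `HolderPicture.deg`; the analytic content is p20's `B3TriangleAlphaGain` / p18's
`B3Eq320PositiveSubgraphs`, cited not restated). [cite: Balaban1983Higgs3, (3.35) p.443] -/
theorem deg_B (α : ℝ) : (picB1 hn α).deg 3 = α ∧ (picB2 hn α).deg 3 = α ∧ (picB5 hn α).deg 3 = α ∧ (picB34pre hn α).deg 3 = α := by
  show ((g220 nbar hn).deg 3 : ℝ) + α = α ∧ ((g220b nbar hn).deg 3 : ℝ) + α = α ∧ ((g220b nbar hn).deg 3 : ℝ) + α = α ∧
    ((g220 nbar hn).deg 3 : ℝ) + α = α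
  rw [deg_g220a, deg_g220b]
  simp

/-! ### The lines enumerated in the printed order 1 < 2 < 3 («the indicated ordering») -/

/-- first endpoints of the lines of a, in print order: line 1 from BL's differentiated leg (the endpoint whose differentiation
(2.9) moves, p19's site convention), line 2 from T's plain leg, line 3 from BL's A′-leg. [cite: Balaban1983Higgs3, (3.35) p.443] -/
def fst220a : Fin 3 → Leg kind220 := fun l => if l = 0 then sBL 0 else if l = 1 then sT 1 else wBL

/-- second endpoints of the lines of a: T's differentiated leg, BR's differentiated leg, BR's A′-leg. [cite: Balaban1983Higgs3, (3.35) p.443] -/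
def snd220a : Fin 3 → Leg kind220 := fun l => if l = 0 then sT 0 else if l = 1 then sBR 0 else wBR

/-- first endpoints of the lines of b, in print order: BL's differentiated leg, T's differentiated leg, BL's A′-leg.
[cite: Balaban1983Higgs3, (3.35) p.443] -/
def fst220b : Fin 3 → Leg kind220 := fun l => if l = 0 then sBL 0 else if l = 1 then sT 0 else wBL

/-- second endpoints of the lines of b: T's plain leg, BR's differentiated leg, BR's A′-leg. [cite: Balaban1983Higgs3, (3.35) p.443] -/
def snd220b : Fin 3 → Leg kind220 := fun l => if l = 0 then sT 1 else if l = 1 then sBR 0 else wBR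

/-- The four properties of an enumeration for a, DECIDED on the closed form. [cite: Balaban1983Higgs3, (2.16) p.428] -/
theorem enum220a_props :
    (∀ l : Fin 3, other220a (fst220a l) = some (snd220a l)) ∧
    (∀ x y : Leg kind220, other220a x = some y → ∃ l : Fin 3, (fst220a l = x ∧ snd220a l = y) ∨ (fst220a l = y ∧ snd220a l = x)) ∧
    (∀ l l' : Fin 3, (fst220a l = fst220a l' ∨ fst220a l = snd220a l') → l = l') ∧
    (∀ v : Fin 3, ∃ l : Fin 3, (fst220a l).1 = v ∨ (snd220a l).1 = v) := by
  refine ⟨by decide, by decide, by decide, by decide⟩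

/-- The four properties of an enumeration for b, DECIDED. [cite: Balaban1983Higgs3, (2.16) p.428] -/
theorem enum220b_props :
    (∀ l : Fin 3, other220b (fst220b l) = some (snd220b l)) ∧
    (∀ x y : Leg kind220, other220b x = some y → ∃ l : Fin 3, (fst220b l = x ∧ snd220b l = y) ∨ (fst220b l = y ∧ snd220b l = x)) ∧
    (∀ l l' : Fin 3, (fst220b l = fst220b l' ∨ fst220b l = snd220b l') → l = l') ∧
    (∀ v : Fin 3, ∃ l : Fin 3, (fst220b l).1 = v ∨ (snd220b l).1 = v) := by
  refine ⟨by decide, by decide, by decide, by decide⟩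

/-- **The lines 1, 2, 3 of a** as an enumeration of p18's `g220` (p19's count datum `countsOf (g220 …) (enum220a …)` is thereby
available). [cite: Balaban1983Higgs3, (3.35) p.443] -/
def enum220a : LineEnum (g220 nbar hn) 3 where
  fst := fst220a
  snd := snd220a
  pair l := (g220_other hn _).trans (enum220a_props.1 l)
  cover x y h := enum220a_props.2.1 x y ((g220_other hn x).symm.trans h)
  nodup := enum220a_props.2.2.1
  touches := enum220a_props.2.2.2

/-- **The lines 1, 2, 3 of b**. [cite: Balaban1983Higgs3, (3.35) p.443] -/
def enum220b : LineEnum (g220b nbar hn) 3 where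
  fst := fst220b
  snd := snd220b
  pair := enum220b_props.1
  cover := enum220b_props.2.1
  nodup := enum220b_props.2.2.1
  touches := enum220b_props.2.2.2

/-- **Line kinds and endpoints are visible**: lines 1, 2 are φ′-lines (straight) from T = `0` to BL = `1`, resp. BR = `2`;
line 3 is the A′-line (wavy) between BL and BR — in both graphs. [cite: Balaban1983Higgs3, (1.17) p.415] -/
theorem enum220_kinds :
    (∀ l : Fin 3, (fst220a l).2.isLeft = decide (l ≠ 2) ∧ (snd220a l).2.isLeft = decide (l ≠ 2) ∧
      (fst220b l).2.isLeft = decide (l ≠ 2) ∧ (snd220b l).2.isLeft = decide (l ≠ 2)) ∧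
    ((fst220a 0).1 = 1 ∧ (snd220a 0).1 = 0 ∧ (fst220a 1).1 = 0 ∧ (snd220a 1).1 = 2 ∧ (fst220a 2).1 = 1 ∧ (snd220a 2).1 = 2) ∧
    ((fst220b 0).1 = 1 ∧ (snd220b 0).1 = 0 ∧ (fst220b 1).1 = 0 ∧ (snd220b 1).1 = 2 ∧ (fst220b 2).1 = 1 ∧ (snd220b 2).1 = 2) := by
  refine ⟨by decide, by decide, by decide⟩

/-! ### The arrowheads: which differentiation acts on which line -/

/-- The differentiations carried by the legs of the triangle, in closed form: each vertex (1.8) differentiates its φ′-leg `0`.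
[cite: Balaban1983Higgs3, (2.1) p.422] -/
def legDiffs220 : Leg kind220 → ℕ
  | ⟨_, .inl j⟩ => if j.val = 0 then 1 else 0
  | ⟨_, .inr _⟩ => 0

/-- p26's `legDiffs` of a and of b are `legDiffs220` (same vertices), and no leg is an averaged vector leg.
[cite: Balaban1983Higgs3, (2.1) p.422] -/
theorem legDiffs_g220 : ∀ x : Leg kind220, legDiffs (g220 nbar hn) x = legDiffs220 x ∧ legDiffs (g220b nbar hn) x = legDiffs220 x ∧
    legAvg (g220 nbar hn) x = 0 ∧ legAvg (g220b nbar hn) x = 0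
  | ⟨0, .inl _⟩ => ⟨rfl, rfl, rfl, rfl⟩
  | ⟨1, .inl _⟩ => ⟨rfl, rfl, rfl, rfl⟩
  | ⟨2, .inl _⟩ => ⟨rfl, rfl, rfl, rfl⟩
  | ⟨0, .inr j⟩ => j.elim0
  | ⟨1, .inr _⟩ => ⟨rfl, rfl, rfl, rfl⟩
  | ⟨2, .inr _⟩ => ⟨rfl, rfl, rfl, rfl⟩

/-- **The arrow pattern of a along the ordering**: line 1 carries the differentiations of BOTH its endpoints (BL's and T's) — the
pattern of the graph (2.4), its first subgraph G₁ = {line 1} *is* (2.4) —; line 2 carries BR's only; line 3 none.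
[cite: Balaban1983Higgs3, (3.35) p.443] -/
theorem pattern220a : (legDiffs220 (fst220a 0) = 1 ∧ legDiffs220 (snd220a 0) = 1) ∧
    (legDiffs220 (fst220a 1) = 0 ∧ legDiffs220 (snd220a 1) = 1) ∧ (legDiffs220 (fst220a 2) = 0 ∧ legDiffs220 (snd220a 2) = 0) := by
  decide

/-- **The arrow pattern of b**: line 1 carries ONE differentiation (BL's; T's plain leg), line 2 both (T's and BR's) — but line 2
shares the vertex T with the earlier line 1, so along the ordering no single-line subgraph of b is the graph (2.4) —, line 3 none.
[cite: Balaban1983Higgs3, (3.35) p.443] -/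
theorem pattern220b : (legDiffs220 (fst220b 0) = 1 ∧ legDiffs220 (snd220b 0) = 0) ∧
    (legDiffs220 (fst220b 1) = 1 ∧ legDiffs220 (snd220b 1) = 1) ∧ (legDiffs220 (fst220b 2) = 0 ∧ legDiffs220 (snd220b 2) = 0) ∧
    (fst220b 1).1 = (snd220b 0).1 := by
  decide

/-- **The arrowheads of a ✱-picture**: at the starred vertex the differentiation no longer sits on its φ′-leg; it sits on its
A′-leg when (2.9) moved it there (✱→), on no leg when it acts on the localization function (✱); elsewhere p26's `legDiffs`.
[cite: Balaban1983Higgs3, (2.9) p.425] -/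
def StarPicture.arrow (S : StarPicture nbar) (x : Leg S.G.kind) : ℕ :=
  if x.1 = S.star then (match S.target, x.2 with
    | .vectorLeg, .inr _ => 1
    | _, _ => 0)
  else legDiffs S.G x

/-- **B3's differentiation arrowheads, derived**: none at BL on line 1, one on the wavy line 3 at BL, T's on line 1 and BR's on
line 2 kept, none on the legs 4, 5 (the outward arrowhead printed on leg 5 is the "−α" mark, `holder_data`, not a differentiation).
[cite: Balaban1983Higgs3, (3.35) p.443] -/
theorem arrows_B3 (α : ℝ) : (picB3 hn α).arrow (sBL 0) = 0 ∧ (picB3 hn α).arrow wBL = 1 ∧ (picB3 hn α).arrow (sT 0) = 1 ∧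
    (picB3 hn α).arrow (sBR 0) = 1 ∧ (picB3 hn α).arrow leg4 = 0 ∧ (picB3 hn α).arrow leg5 = 0 ∧ (picB3 hn α).arrow wBR = 0 :=
  ⟨rfl, rfl, rfl, rfl, rfl, rfl, rfl⟩

/-- **B4's arrowheads, derived**: none at BL at all (the differentiation acts on g), the others as in B3.
[cite: Balaban1983Higgs3, (3.35) p.443] -/
theorem arrows_B4 (α : ℝ) : (picB4 hn α).arrow (sBL 0) = 0 ∧ (picB4 hn α).arrow wBL = 0 ∧ (picB4 hn α).arrow (sT 0) = 1 ∧
    (picB4 hn α).arrow (sBR 0) = 1 ∧ (picB4 hn α).arrow leg4 = 0 ∧ (picB4 hn α).arrow leg5 = 0 ∧ (picB4 hn α).arrow wBR = 0 :=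
  ⟨rfl, rfl, rfl, rfl, rfl, rfl, rfl⟩

/-- B1, B2, B5 keep all arrowheads of a, resp. b (they are decorations of the natural pictures / of b with leg 4 moved).
[cite: Balaban1983Higgs3, (3.35) p.443] -/
theorem arrows_B125 (α : ℝ) : (picB1 hn α).G = g220 nbar hn ∧ (picB2 hn α).G = g220b nbar hn ∧ (picB5 hn α).G = g220b nbar hn :=
  ⟨rfl, rfl, rfl⟩

/-! ### The (2.4)-block {T, BL, line 1} of a: degree 0, and +1 after (2.9) (p. 425) -/

/-- The block {T, BL, line 1} of a READ OFF the drawing as r15's vertex data: T = (1.8)_{0,1} and BL = (1.8)_{1,0}, each with ONE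
φ′-leg on the line (`enum220_kinds`: line 1 = (sBL 0, sT 0)), no A′-leg on it, and its differentiation on it (`pattern220a`) —
after (2.9) at BL (`ibp = true`) BL's differentiation is no longer on the line (`arrows_B3/B4`). [cite: Balaban1983Higgs3, (2.4) p.424] -/
def block1Data (d : ℕ) (ibp : Bool) (v : Fin 2) : GraphVertex :=
  if v = 0 then ⟨toCounts d (kind220 0), ⟨1, 0, 1, by simp [toCounts, kind220, VertexKind.scalarLegs], Nat.zero_le _,
    by simp [toCounts, kind220, VertexKind.diffCount]⟩, 0⟩
  else ⟨toCounts d (kind220 1), ⟨1, 0, if ibp then 0 else 1, by simp [toCounts, kind220, VertexKind.scalarLegs], Nat.zero_le _,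
    by cases ibp <;> simp [toCounts, kind220, VertexKind.diffCount]⟩, 0⟩

/-- **The first subgraph of a is the graph (2.4): degree 0** in every d ((2.2) on the block, r15's `graphDegree`; cf. r15's
`degree_graph24` for equal vertex kinds). [cite: Balaban1983Higgs3, (2.4) p.424] -/
theorem deg_block1_a (d : ℕ) : graphDegree d univ (block1Data d false) = 0 := by
  simp [graphDegree, degreeIn, block1Data, toCounts, kind220, VertexKind.etaCount, Fin.sum_univ_two]
  ring

/-- **p. 425: "the graphs (2.4) are replaced by the graphs with degree +1"** — after (2.9) at BL the block has degree 1 (B3 and B4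
alike: in both the differentiation left line 1). [cite: Balaban1983Higgs3, (2.9) p.425] -/
theorem deg_block1_star (d : ℕ) : graphDegree d univ (block1Data d true) = 1 := by
  simp [graphDegree, degreeIn, block1Data, toCounts, kind220, VertexKind.etaCount, Fin.sum_univ_two]
  ring

end Counting

/-! ## 3. The dictionary: the pictures of (3.35) ↦ expressions on the torus `T^{(j)}_η` (r15's carriers) -/

section Dictionary

open B3Prop1 B3Cor23Concrete B3Sect2ThreeLegGraphs B3Eq37Pictures B3Eq332Pictures
open LatticeFieldCalculus (supDist pdiff pdiffAdj shiftEquiv)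
open B3Sect3TriangleGraphs (Kernel3 tripleSum expr333)

open scoped RealInnerProductSpace

noncomputable section

variable {nbar : ℕ} {P : Params} {j : ℕ} {W : Type*} [NormedAddCommGroup W] [InnerProductSpace ℝ W]

/-- **The expression of a localized three-leg picture** (the form (3.33)): the external vector leg (field g·A_μ, A_μ(x) = A ⟨x, μ⟩
as in r15's `expr333`) at the vertex `v0`, the scalar legs `e′` (field φ′) and `e″` (field φ″) AT THEIR LOCALIZATION VERTICES, a
kernel `K(xs)_μ` acting on the internal indices (r15's `W →ₗ[ℝ] W`), summed over all vertex positions with η^{(#vertices)·d}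
(p26's `LocPicture.amp` with the vector leg added).  The kernel is supplied by the caller. [cite: Balaban1983Higgs3, (3.33) p.443] -/
def amp3 (Pic : LocPicture nbar) (v0 : Fin Pic.G.nV) (e' e'' : Leg Pic.G.kind) (η : ℝ)
    (K : (Fin Pic.G.nV → Site P j) → Fin P.d → W →ₗ[ℝ] W) (g : SiteField P j ℝ) (A : VecField P j ℝ)
    (φ' φ'' : SiteField P j W) : ℝ :=
  ∑ xs : Fin Pic.G.nV → Site P j, η ^ (Pic.G.nV * P.d) * ∑ μ : Fin P.d,
    g (xs v0) * A ⟨xs v0, μ⟩ * ⟪φ' (xs (Pic.loc e')), K xs μ (φ'' (xs (Pic.loc e'')))⟫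

/-- **The reading of a "−α" leg** of a scalar field relative to the base point `xb`: |x_w − x_b|^α·((φ(x_w) − φ(x_b))/|x_w − x_b|^α)
with |·| = η·(sup torus distance), exactly the transported scalar leg of r15's `eq334` (the weight is the "+α" of the line).
[cite: Balaban1983Higgs3, (3.34) p.443] -/
def holderLeg (η α : ℝ) (φ : SiteField P j W) (xb xw : Site P j) : W :=
  (η * supDist xw xb) ^ α • (((η * supDist xw xb) ^ α)⁻¹ • (φ xw - φ xb))

/-- **The expression of a decorated picture whose "−α" leg is the φ′-leg** (B1, B2): as `amp3` with the decorated leg read by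
`holderLeg` relative to `base`, the plain scalar leg `e″` at its localization vertex. [cite: Balaban1983Higgs3, (3.35) p.443] -/
def ampH3L (H : HolderPicture nbar) (v0 : Fin H.G.nV) (e'' : Leg H.G.kind) (η : ℝ)
    (K : (Fin H.G.nV → Site P j) → Fin P.d → W →ₗ[ℝ] W) (g : SiteField P j ℝ) (A : VecField P j ℝ)
    (φ' φ'' : SiteField P j W) : ℝ :=
  ∑ xs : Fin H.G.nV → Site P j, η ^ (H.G.nV * P.d) * ∑ μ : Fin P.d,
    g (xs v0) * A ⟨xs v0, μ⟩ * ⟪holderLeg η H.α φ' (xs H.base) (xs (H.loc H.wleg)), K xs μ (φ'' (xs (H.loc e'')))⟫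

/-- **The expression of a decorated picture whose "−α" leg is the φ″-leg** (B3, B4, B5 and the intermediate term).
[cite: Balaban1983Higgs3, (3.35) p.443] -/
def ampH3R (H : HolderPicture nbar) (v0 : Fin H.G.nV) (e' : Leg H.G.kind) (η : ℝ)
    (K : (Fin H.G.nV → Site P j) → Fin P.d → W →ₗ[ℝ] W) (g : SiteField P j ℝ) (A : VecField P j ℝ)
    (φ' φ'' : SiteField P j W) : ℝ :=
  ∑ xs : Fin H.G.nV → Site P j, η ^ (H.G.nV * P.d) * ∑ μ : Fin P.d,
    g (xs v0) * A ⟨xs v0, μ⟩ * ⟪φ' (xs (H.loc e')), K xs μ (holderLeg η H.α φ'' (xs H.base) (xs (H.loc H.wleg)))⟫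

/-- A three-point kernel Γ_μ(x,x′,x″) of r15 as a function of the positions of the three vertices T = `xs 0`, BL = `xs 1`,
BR = `xs 2`. [cite: Balaban1983Higgs3, (3.33) p.443] -/
def kernel3V (Γ : Kernel3 P j W) (xs : Fin 3 → Site P j) (μ : Fin P.d) : W →ₗ[ℝ] W := Γ μ (xs 0) (xs 1) (xs 2)

/-- **The local term at the vector vertex** (R1/R2 of (3.35)): Σ_xη^dΣ_μ g(x)A_μ(x)φ′(x)·(Σ_{x′,x″}η^{2d}Γ_μ(x,x′,x″))φ″(x) — the
last term of (3.34) with the legs sent to the vertex of the leg 6 instead of the vertex of φ′ (r15's `local334` has them at x′).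
[cite: Balaban1983Higgs3, (3.35) p.443] -/
def local335 (η : ℝ) (Γ : Kernel3 P j W) (g : SiteField P j ℝ) (A : VecField P j ℝ) (φ' φ'' : SiteField P j W) : ℝ :=
  ∑ x : Site P j, η ^ P.d * ∑ μ : Fin P.d, g x * A ⟨x, μ⟩ *
    ⟪φ' x, (∑ x' : Site P j, ∑ x'' : Site P j, η ^ (2 * P.d) • Γ μ x x' x'') (φ'' x)⟫

/-- kernel: a sum over the positions of three vertices is a triple sum. [folklore] -/
private theorem sum_arrow_fin_three {α M : Type*} [Fintype α] [AddCommMonoid M] (f : (Fin 3 → α) → M) :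
    ∑ xs : Fin 3 → α, f xs = ∑ a : α, ∑ b : α, ∑ c : α, f ![a, b, c] := by
  rw [← Equiv.sum_comp (Fin.consEquiv fun _ : Fin 3 => α) f, Fintype.sum_prod_type]
  refine Finset.sum_congr rfl fun a _ => ?_
  rw [← Equiv.sum_comp (finTwoArrowEquiv α).symm, Fintype.sum_prod_type]
  refine Finset.sum_congr rfl fun b _ => Finset.sum_congr rfl fun c _ => ?_
  congr 1

/-- kernel: η^{3d} = η^d·η^{2d}. [folklore] -/
private theorem pow_three_mul (η : ℝ) (n : ℕ) : η ^ (3 * n) = η ^ n * η ^ (2 * n) := by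
  rw [← pow_add]
  congr 1
  ring

variable (hn : 1 ≤ nbar)

/-! ### LHS ↦ (3.33) -/

/-- **a ↦ (3.33)**: with the kernel Γ of the graph a, the first picture of (3.35) is r15's `expr333 η Γ` — gA_μ at T = x, φ′ at
BL = x′, φ″ at BR = x″. [cite: Balaban1983Higgs3, (3.33) p.443] -/
theorem amp3_picA (η : ℝ) (Γ : Kernel3 P j W) (g : SiteField P j ℝ) (A : VecField P j ℝ) (φ' φ'' : SiteField P j W) :
    amp3 (picA hn) (0 : Fin 3) leg4 leg5 η (kernel3V Γ) g A φ' φ'' = expr333 η Γ g A φ' φ'' := by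
  unfold amp3 expr333 tripleSum
  show ∑ xs : Fin 3 → Site P j, η ^ (3 * P.d) * ∑ μ : Fin P.d,
      g (xs 0) * A ⟨xs 0, μ⟩ * ⟪φ' (xs 1), Γ μ (xs 0) (xs 1) (xs 2) (φ'' (xs 2))⟫ = _
  rw [sum_arrow_fin_three]
  refine Finset.sum_congr rfl fun x _ => Finset.sum_congr rfl fun x' _ => Finset.sum_congr rfl fun x'' _ => ?_
  simp only [Matrix.cons_val_zero, Matrix.cons_val_one, Matrix.cons_val_two, Matrix.head_cons, Matrix.tail_cons]

/-- **b ↦ (3.33)** with the kernel of the graph b (same legs, same vertices). [cite: Balaban1983Higgs3, (3.33) p.443] -/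
theorem amp3_picB (η : ℝ) (Γ : Kernel3 P j W) (g : SiteField P j ℝ) (A : VecField P j ℝ) (φ' φ'' : SiteField P j W) :
    amp3 (picB hn) (0 : Fin 3) leg4 leg5 η (kernel3V Γ) g A φ' φ'' = expr333 η Γ g A φ' φ'' := by
  unfold amp3 expr333 tripleSum
  show ∑ xs : Fin 3 → Site P j, η ^ (3 * P.d) * ∑ μ : Fin P.d,
      g (xs 0) * A ⟨xs 0, μ⟩ * ⟪φ' (xs 1), Γ μ (xs 0) (xs 1) (xs 2) (φ'' (xs 2))⟫ = _
  rw [sum_arrow_fin_three]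
  refine Finset.sum_congr rfl fun x _ => Finset.sum_congr rfl fun x' _ => Finset.sum_congr rfl fun x'' _ => ?_
  simp only [Matrix.cons_val_zero, Matrix.cons_val_one, Matrix.cons_val_two, Matrix.head_cons, Matrix.tail_cons]

/-! ### R1, R2 ↦ the local term at T -/

/-- the localizations of R1/R2 at the legs 4, 5, as used by the dictionary. [cite: Balaban1983Higgs3, (3.35) p.443] -/
private theorem locR (hn : 1 ≤ nbar) : (picR1 hn).loc leg4 = (0 : Fin 3) ∧ (picR1 hn).loc leg5 = (0 : Fin 3) ∧
    (picR2 hn).loc leg4 = (0 : Fin 3) ∧ (picR2 hn).loc leg5 = (0 : Fin 3) :=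
  ⟨(loc_pics hn).2.1, (loc_pics hn).2.2.1, (loc_pics hn).2.1, (loc_pics hn).2.2.1⟩

/-- kernel: the local reading collapses the x′, x″ sums onto the kernel (r15's `tripleSum_local`, at T). [cite: Balaban1983Higgs3, (3.34) p.443] -/
private theorem triple_local (η : ℝ) (Γ : Kernel3 P j W) (g : SiteField P j ℝ) (A : VecField P j ℝ) (φ' φ'' : SiteField P j W) :
    (∑ x : Site P j, ∑ x' : Site P j, ∑ x'' : Site P j, η ^ (3 * P.d) * ∑ μ : Fin P.d,
        g x * A ⟨x, μ⟩ * ⟪φ' x, Γ μ x x' x'' (φ'' x)⟫) = local335 η Γ g A φ' φ'' := by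
  have hR : local335 η Γ g A φ' φ'' = ∑ x : Site P j, ∑ μ : Fin P.d, ∑ x' : Site P j, ∑ x'' : Site P j,
      η ^ (3 * P.d) * (g x * A ⟨x, μ⟩ * ⟪φ' x, Γ μ x x' x'' (φ'' x)⟫) := by
    simp only [local335, LinearMap.sum_apply, LinearMap.smul_apply, inner_sum, inner_smul_right, Finset.mul_sum]
    refine Finset.sum_congr rfl fun x _ => Finset.sum_congr rfl fun μ _ =>
      Finset.sum_congr rfl fun x' _ => Finset.sum_congr rfl fun x'' _ => ?_
    rw [pow_three_mul]
    ring
  rw [hR]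
  refine Finset.sum_congr rfl fun x _ => ?_
  calc (∑ x' : Site P j, ∑ x'' : Site P j, η ^ (3 * P.d) * ∑ μ : Fin P.d, g x * A ⟨x, μ⟩ * ⟪φ' x, Γ μ x x' x'' (φ'' x)⟫)
      = ∑ x' : Site P j, ∑ x'' : Site P j, ∑ μ : Fin P.d, η ^ (3 * P.d) * (g x * A ⟨x, μ⟩ * ⟪φ' x, Γ μ x x' x'' (φ'' x)⟫) :=
        Finset.sum_congr rfl fun x' _ => Finset.sum_congr rfl fun x'' _ => Finset.mul_sum _ _ _
    _ = ∑ x' : Site P j, ∑ μ : Fin P.d, ∑ x'' : Site P j, η ^ (3 * P.d) * (g x * A ⟨x, μ⟩ * ⟪φ' x, Γ μ x x' x'' (φ'' x)⟫) :=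
        Finset.sum_congr rfl fun x' _ => Finset.sum_comm
    _ = ∑ μ : Fin P.d, ∑ x' : Site P j, ∑ x'' : Site P j, η ^ (3 * P.d) * (g x * A ⟨x, μ⟩ * ⟪φ' x, Γ μ x x' x'' (φ'' x)⟫) :=
        Finset.sum_comm

/-- **R1 ↦ the local term at T**: with both scalar legs at T the x′, x″ sums collapse onto the kernel.
[cite: Balaban1983Higgs3, (3.35) p.443] -/
theorem amp3_picR1 (η : ℝ) (Γ : Kernel3 P j W) (g : SiteField P j ℝ) (A : VecField P j ℝ) (φ' φ'' : SiteField P j W) :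
    amp3 (picR1 hn) (0 : Fin 3) leg4 leg5 η (kernel3V Γ) g A φ' φ'' = local335 η Γ g A φ' φ'' := by
  unfold amp3
  simp only [(locR hn).1, (locR hn).2.1]
  show ∑ xs : Fin 3 → Site P j, η ^ (3 * P.d) * ∑ μ : Fin P.d,
      g (xs 0) * A ⟨xs 0, μ⟩ * ⟪φ' (xs 0), Γ μ (xs 0) (xs 1) (xs 2) (φ'' (xs 0))⟫ = _
  rw [sum_arrow_fin_three, ← triple_local]
  rfl

/-- **R2 ↦ the same local term** (with the kernel of b). [cite: Balaban1983Higgs3, (3.35) p.443] -/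
theorem amp3_picR2 (η : ℝ) (Γ : Kernel3 P j W) (g : SiteField P j ℝ) (A : VecField P j ℝ) (φ' φ'' : SiteField P j W) :
    amp3 (picR2 hn) (0 : Fin 3) leg4 leg5 η (kernel3V Γ) g A φ' φ'' = local335 η Γ g A φ' φ'' := by
  unfold amp3
  simp only [(locR hn).2.2.1, (locR hn).2.2.2]
  show ∑ xs : Fin 3 → Site P j, η ^ (3 * P.d) * ∑ μ : Fin P.d,
      g (xs 0) * A ⟨xs 0, μ⟩ * ⟪φ' (xs 0), Γ μ (xs 0) (xs 1) (xs 2) (φ'' (xs 0))⟫ = _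
  rw [sum_arrow_fin_three, ← triple_local]
  rfl

/-! ### The transport to T, PROVED for every kernel: [natural] = [leg 4 decorated] + [leg 4 at T, leg 5 decorated] + [local] -/

/-- kernel: on the torus, sup-distance 0 means equality. [folklore] -/
private theorem eq_of_supDist_eq_zero (x x' : Site P j) (h : supDist x x' = 0) : x = x' := by
  funext μ
  have hle : min (x μ - x' μ).val (x' μ - x μ).val ≤ supDist x x' :=
    Finset.le_sup (f := fun μ : Fin P.d => min (x μ - x' μ).val (x' μ - x μ).val) (Finset.mem_univ μ)
  rw [h, Nat.le_zero, Nat.min_eq_zero_iff, ZMod.val_eq_zero, ZMod.val_eq_zero, sub_eq_zero, sub_eq_zero] at hle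
  rcases hle with h1 | h1
  · exact h1
  · exact h1.symm

/-- kernel: the transported leg plus the local value is the original leg (the weight vanishes only on the diagonal, η > 0).
[cite: Balaban1983Higgs3, (3.34) p.443] -/
private theorem holderLeg_add {η : ℝ} (hη : 0 < η) (α : ℝ) (φ : SiteField P j W) (xb xw : Site P j) :
    holderLeg η α φ xb xw + φ xb = φ xw := by
  unfold holderLeg
  by_cases h0 : (η * (supDist xw xb : ℝ)) ^ α = 0
  · have hnn : 0 ≤ η * (supDist xw xb : ℝ) := by positivity
    rw [Real.rpow_eq_zero_iff_of_nonneg hnn] at h0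
    have h1 : (supDist xw xb : ℝ) = 0 := by
      rcases mul_eq_zero.1 h0.1 with h2 | h2
      · exact absurd h2 hη.ne'
      · exact h2
    have hx : xw = xb := eq_of_supDist_eq_zero xw xb (by exact_mod_cast h1)
    subst hx
    rw [sub_self, smul_zero, smul_zero, zero_add]
  · rw [smul_smul, mul_inv_cancel₀ h0, one_smul, sub_add_cancel]

/-- kernel: the transport of both scalar legs to x, pointwise inside the pairing. [cite: Balaban1983Higgs3, (3.34) p.443] -/
private theorem transport_point {η : ℝ} (hη : 0 < η) (α : ℝ) (L : W →ₗ[ℝ] W) (φ' φ'' : SiteField P j W) (x x' x'' : Site P j) :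
    ⟪φ' x', L (φ'' x'')⟫ = ⟪holderLeg η α φ' x x', L (φ'' x'')⟫ + ⟪φ' x, L (holderLeg η α φ'' x x'')⟫ + ⟪φ' x, L (φ'' x)⟫ := by
  rw [add_assoc, ← inner_add_right, ← map_add, holderLeg_add hη, ← inner_add_left, holderLeg_add hη]

/-- the localizations of B1 and of the intermediate term, as used by the dictionary. [cite: Balaban1983Higgs3, (3.35) p.443] -/
private theorem locA (hn : 1 ≤ nbar) (α : ℝ) : (picB1 hn α).loc (picB1 hn α).wleg = (1 : Fin 3) ∧
    (picB1 hn α).loc leg5 = (2 : Fin 3) ∧ (picB34pre hn α).loc leg4 = (0 : Fin 3) ∧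
    (picB34pre hn α).loc (picB34pre hn α).wleg = (2 : Fin 3) ∧ (picA hn).loc leg4 = (1 : Fin 3) ∧ (picA hn).loc leg5 = (2 : Fin 3) :=
  ⟨rfl, rfl, (loc4T_legs hn).1, (loc4T_legs hn).2.1, rfl, rfl⟩

/-- the localizations of B2 and B5. [cite: Balaban1983Higgs3, (3.35) p.443] -/
private theorem locB (hn : 1 ≤ nbar) (α : ℝ) : (picB2 hn α).loc (picB2 hn α).wleg = (1 : Fin 3) ∧
    (picB2 hn α).loc leg5 = (2 : Fin 3) ∧ (picB5 hn α).loc leg4 = (0 : Fin 3) ∧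
    (picB5 hn α).loc (picB5 hn α).wleg = (2 : Fin 3) ∧ (picB hn).loc leg4 = (1 : Fin 3) ∧ (picB hn).loc leg5 = (2 : Fin 3) :=
  ⟨rfl, rfl, (loc4T_legs hn).1, (loc4T_legs hn).2.1, rfl, rfl⟩

/-- **The transport of a to T** ((3.34)'s algebra with the legs sent to the vector vertex), PROVED for every kernel, η > 0 and every
real α: [a] = [B1] + [the intermediate term: leg 4 at T, leg 5 decorated] + [R1]. [cite: Balaban1983Higgs3, (3.35) p.443] -/
theorem eq335_transport_a (η α : ℝ) (hη : 0 < η) (Γ : Kernel3 P j W) (g : SiteField P j ℝ) (A : VecField P j ℝ)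
    (φ' φ'' : SiteField P j W) :
    amp3 (picA hn) (0 : Fin 3) leg4 leg5 η (kernel3V Γ) g A φ' φ'' =
      ampH3L (picB1 hn α) (0 : Fin 3) leg5 η (kernel3V Γ) g A φ' φ'' +
        ampH3R (picB34pre hn α) (0 : Fin 3) leg4 η (kernel3V Γ) g A φ' φ'' +
        amp3 (picR1 hn) (0 : Fin 3) leg4 leg5 η (kernel3V Γ) g A φ' φ'' := by
  unfold amp3 ampH3L ampH3R
  simp only [(locA hn α).1, (locA hn α).2.1, (locA hn α).2.2.1, (locA hn α).2.2.2.1, (locA hn α).2.2.2.2.1,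
    (locA hn α).2.2.2.2.2, (locR hn).1, (locR hn).2.1]
  show ∑ xs : Fin 3 → Site P j, η ^ (3 * P.d) * ∑ μ : Fin P.d,
      g (xs 0) * A ⟨xs 0, μ⟩ * ⟪φ' (xs 1), Γ μ (xs 0) (xs 1) (xs 2) (φ'' (xs 2))⟫ =
    (∑ xs : Fin 3 → Site P j, η ^ (3 * P.d) * ∑ μ : Fin P.d,
      g (xs 0) * A ⟨xs 0, μ⟩ * ⟪holderLeg η α φ' (xs 0) (xs 1), Γ μ (xs 0) (xs 1) (xs 2) (φ'' (xs 2))⟫) +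
    (∑ xs : Fin 3 → Site P j, η ^ (3 * P.d) * ∑ μ : Fin P.d,
      g (xs 0) * A ⟨xs 0, μ⟩ * ⟪φ' (xs 0), Γ μ (xs 0) (xs 1) (xs 2) (holderLeg η α φ'' (xs 0) (xs 2))⟫) +
    ∑ xs : Fin 3 → Site P j, η ^ (3 * P.d) * ∑ μ : Fin P.d,
      g (xs 0) * A ⟨xs 0, μ⟩ * ⟪φ' (xs 0), Γ μ (xs 0) (xs 1) (xs 2) (φ'' (xs 0))⟫
  rw [← Finset.sum_add_distrib, ← Finset.sum_add_distrib]
  refine Finset.sum_congr rfl fun xs _ => ?_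
  rw [← mul_add, ← mul_add, ← Finset.sum_add_distrib, ← Finset.sum_add_distrib]
  congr 1
  refine Finset.sum_congr rfl fun μ _ => ?_
  rw [← mul_add, ← mul_add, ← transport_point hη]

/-- **The transport of b to T**: [b] = [B2] + [B5] + [R2], for every kernel. [cite: Balaban1983Higgs3, (3.35) p.443] -/
theorem eq335_transport_b (η α : ℝ) (hη : 0 < η) (Γ : Kernel3 P j W) (g : SiteField P j ℝ) (A : VecField P j ℝ)
    (φ' φ'' : SiteField P j W) :
    amp3 (picB hn) (0 : Fin 3) leg4 leg5 η (kernel3V Γ) g A φ' φ'' =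
      ampH3L (picB2 hn α) (0 : Fin 3) leg5 η (kernel3V Γ) g A φ' φ'' +
        ampH3R (picB5 hn α) (0 : Fin 3) leg4 η (kernel3V Γ) g A φ' φ'' +
        amp3 (picR2 hn) (0 : Fin 3) leg4 leg5 η (kernel3V Γ) g A φ' φ'' := by
  unfold amp3 ampH3L ampH3R
  simp only [(locB hn α).1, (locB hn α).2.1, (locB hn α).2.2.1, (locB hn α).2.2.2.1, (locB hn α).2.2.2.2.1,
    (locB hn α).2.2.2.2.2, (locR hn).2.2.1, (locR hn).2.2.2]
  show ∑ xs : Fin 3 → Site P j, η ^ (3 * P.d) * ∑ μ : Fin P.d,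
      g (xs 0) * A ⟨xs 0, μ⟩ * ⟪φ' (xs 1), Γ μ (xs 0) (xs 1) (xs 2) (φ'' (xs 2))⟫ =
    (∑ xs : Fin 3 → Site P j, η ^ (3 * P.d) * ∑ μ : Fin P.d,
      g (xs 0) * A ⟨xs 0, μ⟩ * ⟪holderLeg η α φ' (xs 0) (xs 1), Γ μ (xs 0) (xs 1) (xs 2) (φ'' (xs 2))⟫) +
    (∑ xs : Fin 3 → Site P j, η ^ (3 * P.d) * ∑ μ : Fin P.d,
      g (xs 0) * A ⟨xs 0, μ⟩ * ⟪φ' (xs 0), Γ μ (xs 0) (xs 1) (xs 2) (holderLeg η α φ'' (xs 0) (xs 2))⟫) +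
    ∑ xs : Fin 3 → Site P j, η ^ (3 * P.d) * ∑ μ : Fin P.d,
      g (xs 0) * A ⟨xs 0, μ⟩ * ⟪φ' (xs 0), Γ μ (xs 0) (xs 1) (xs 2) (φ'' (xs 0))⟫
  rw [← Finset.sum_add_distrib, ← Finset.sum_add_distrib]
  refine Finset.sum_congr rfl fun xs _ => ?_
  rw [← mul_add, ← mul_add, ← Finset.sum_add_distrib, ← Finset.sum_add_distrib]
  congr 1
  refine Finset.sum_congr rfl fun μ _ => ?_
  rw [← mul_add, ← mul_add, ← transport_point hη]

/-! ### (2.9) at BL, PROVED on the torus: [intermediate term] = [B3] + [B4] -/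

/-- **A kernel with the structure of the vertex (1.8) at BL** (Sect. 3: the background gauged away, p. 433, so (2.8) carries the
plain lattice derivative): as a function of the position x′ of BL it is Σ_ν (∂^η_ν of the line-1 end `K_μ(x,·)`)(x′) ∘ (g₁(x′)·(the
line-3 end `M_{μν}(x,x′,x″)`)) — the differentiation of BL on its φ′-leg lying on line 1, its localization function g₁, its A′-leg
on line 3 (everything beyond BL is inside `K` and `M`, supplied by the caller; `c = η⁻¹`).  The kernels of (2.20) as products of
propagators are not typed (r15 keeps Γ abstract); this records only the part of the structure that (2.9) uses.
[cite: Balaban1983Higgs3, (2.8) p.425] -/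
def kerBL (c : ℝ) (K : Fin P.d → Site P j → SiteField P j (W →ₗ[ℝ] W)) (g₁ : SiteField P j ℝ)
    (M : Fin P.d → Fin P.d → Site P j → Site P j → Site P j → (W →ₗ[ℝ] W)) : Kernel3 P j W :=
  fun μ x x' x'' => ∑ ν : Fin P.d, (pdiff c ν (K μ x) x') ∘ₗ (g₁ x' • M μ ν x x' x'')

/-- **The ✱→ kernel** (first notation of (2.9): the differentiation moved onto the A′-leg, *"(∂^{η*}A′)(x)"* of (2.8)): Σ_ν K_μ(x,x′)
∘ (g₁(x′)·(∂^{η*}_ν of the line-3 end in x′)). [cite: Balaban1983Higgs3, (2.8) p.425] -/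
def kerStarVec (c : ℝ) (K : Fin P.d → Site P j → SiteField P j (W →ₗ[ℝ] W)) (g₁ : SiteField P j ℝ)
    (M : Fin P.d → Fin P.d → Site P j → Site P j → Site P j → (W →ₗ[ℝ] W)) : Kernel3 P j W :=
  fun μ x x' x'' => ∑ ν : Fin P.d, (K μ x x') ∘ₗ (g₁ x' • pdiffAdj c ν (fun y => M μ ν x y x'') x')

/-- **The ✱ kernel** (second notation of (2.9): the differentiation on the localization function, the A′-leg shifted,
*"(∂^{η*}_μ g)(x)A′_μ(x − ηe_μ)"* of (2.8)): Σ_ν K_μ(x,x′) ∘ ((∂^{η*}_ν g₁)(x′)·M_{μν}(x, x′ − e_ν, x″)). [cite: Balaban1983Higgs3, (2.8) p.425] -/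
def kerStarLoc (c : ℝ) (K : Fin P.d → Site P j → SiteField P j (W →ₗ[ℝ] W)) (g₁ : SiteField P j ℝ)
    (M : Fin P.d → Fin P.d → Site P j → Site P j → Site P j → (W →ₗ[ℝ] W)) : Kernel3 P j W :=
  fun μ x x' x'' => ∑ ν : Fin P.d, (K μ x x') ∘ₗ (pdiffAdj c ν g₁ x' • M μ ν x (x'.unshift ν) x'')

/-- kernel: `(x + e_ν) − e_ν = x` on the torus (`LatticeFieldCalculus.shiftEquiv`). [folklore] -/
private theorem unshift_shift (y : Site P j) (ν : Fin P.d) : (y.shift ν).unshift ν = y :=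
  (shiftEquiv (P := P) (j := j) ν).left_inv y

/-- kernel: SUMMATION BY PARTS for operator-valued site functions under composition, Σ_y (∂_ν F)(y) ∘ G(y) = Σ_y F(y) ∘ (∂*_ν G)(y)
(no boundary on the torus; `LatticeFieldCalculus.sum_pdiff_mul` is the real-valued case). [cite: Balaban1984PropagatorsI, (1.21) p.21] -/
private theorem sum_pdiff_comp (c : ℝ) (ν : Fin P.d) (F G : SiteField P j (W →ₗ[ℝ] W)) :
    ∑ y : Site P j, (pdiff c ν F y) ∘ₗ (G y) = ∑ y : Site P j, (F y) ∘ₗ (pdiffAdj c ν G y) := by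
  simp only [pdiff, pdiffAdj, LinearMap.smul_comp, LinearMap.comp_smul, LinearMap.sub_comp, LinearMap.comp_sub, smul_sub,
    Finset.sum_sub_distrib]
  congr 1
  have h := Equiv.sum_comp (shiftEquiv (P := P) (j := j) ν) (fun y => c • ((F y) ∘ₗ (G (y.unshift ν))))
  refine Eq.trans (Finset.sum_congr rfl fun y _ => ?_) h
  show c • (F (y.shift ν) ∘ₗ G y) = c • (F (y.shift ν) ∘ₗ G ((y.shift ν).unshift ν))
  rw [unshift_shift]

/-- kernel: the LEIBNIZ RULE for ∂*_ν on a product (scalar function)·(operator function), in the form of (2.8):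
∂*_ν(g·M)(y) = (∂*_ν g)(y)·M(y − e_ν) + g(y)·(∂*_ν M)(y). [cite: Balaban1983Higgs3, (2.8) p.425] -/
private theorem pdiffAdj_smul (c : ℝ) (ν : Fin P.d) (g₁ : SiteField P j ℝ) (M' : SiteField P j (W →ₗ[ℝ] W)) (y : Site P j) :
    pdiffAdj c ν (fun z => g₁ z • M' z) y = pdiffAdj c ν g₁ y • M' (y.unshift ν) + g₁ y • pdiffAdj c ν M' y := by
  simp only [pdiffAdj, smul_eq_mul]
  module

/-- **(2.8)/(2.9) at BL on the torus, PROVED**: summed over the position of BL, the (1.8)-structured kernel is the ✱→ kernel plus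
the ✱ kernel — summation by parts moves ∂^η off the line-1 end, the Leibniz rule splits ∂^{η*}(g₁·M); the third notation of (2.9)
does not arise because nothing else at BL depends on x′ (leg 4 sits at T).  The vertex-level identity with the covariant
derivative and both φ′-legs present is p20's `B3Eq28SummationByParts.eq28_two`. [cite: Balaban1983Higgs3, (2.9) p.425] -/
theorem sum_kerBL (c : ℝ) (K : Fin P.d → Site P j → SiteField P j (W →ₗ[ℝ] W)) (g₁ : SiteField P j ℝ)
    (M : Fin P.d → Fin P.d → Site P j → Site P j → Site P j → (W →ₗ[ℝ] W)) (μ : Fin P.d) (x x'' : Site P j) :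
    ∑ x' : Site P j, kerBL c K g₁ M μ x x' x'' =
      ∑ x' : Site P j, kerStarVec c K g₁ M μ x x' x'' + ∑ x' : Site P j, kerStarLoc c K g₁ M μ x x' x'' := by
  simp only [kerBL, kerStarVec, kerStarLoc]
  have hν : ∀ ν : Fin P.d, ∑ x' : Site P j, (pdiff c ν (K μ x) x') ∘ₗ (g₁ x' • M μ ν x x' x'') =
      ∑ x' : Site P j, ((K μ x x') ∘ₗ (g₁ x' • pdiffAdj c ν (fun y => M μ ν x y x'') x') +
        (K μ x x') ∘ₗ (pdiffAdj c ν g₁ x' • M μ ν x (x'.unshift ν) x'')) := by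
    intro ν
    rw [sum_pdiff_comp c ν (K μ x) (fun y => g₁ y • M μ ν x y x'')]
    refine Finset.sum_congr rfl fun x' _ => ?_
    rw [pdiffAdj_smul, LinearMap.comp_add, add_comm]
  calc ∑ x' : Site P j, ∑ ν : Fin P.d, (pdiff c ν (K μ x) x') ∘ₗ (g₁ x' • M μ ν x x' x'')
      = ∑ ν : Fin P.d, ∑ x' : Site P j, (pdiff c ν (K μ x) x') ∘ₗ (g₁ x' • M μ ν x x' x'') := Finset.sum_comm
    _ = ∑ ν : Fin P.d, ∑ x' : Site P j, ((K μ x x') ∘ₗ (g₁ x' • pdiffAdj c ν (fun y => M μ ν x y x'') x') +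
          (K μ x x') ∘ₗ (pdiffAdj c ν g₁ x' • M μ ν x (x'.unshift ν) x'')) := Finset.sum_congr rfl fun ν _ => hν ν
    _ = ∑ x' : Site P j, ∑ ν : Fin P.d, ((K μ x x') ∘ₗ (g₁ x' • pdiffAdj c ν (fun y => M μ ν x y x'') x') +
          (K μ x x') ∘ₗ (pdiffAdj c ν g₁ x' • M μ ν x (x'.unshift ν) x'')) := Finset.sum_comm
    _ = _ := by simp only [Finset.sum_add_distrib]

/-- kernel: in the leg-5-decorated pictures of a with leg 4 at T (the intermediate term, B3, B4 — one `HolderPicture`) nothing but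
the kernel depends on the position of BL: the expression is Σ_{x,x″}η^{3d}Σ_μ gA_μ(x)φ′(x)·(Σ_{x′}Γ_μ(x,x′,x″))(leg 5 decorated).
[cite: Balaban1983Higgs3, (3.35) p.443] -/
theorem ampH3R_B34pre (η α : ℝ) (Γ : Kernel3 P j W) (g : SiteField P j ℝ) (A : VecField P j ℝ) (φ' φ'' : SiteField P j W) :
    ampH3R (picB34pre hn α) (0 : Fin 3) leg4 η (kernel3V Γ) g A φ' φ'' =
      ∑ x : Site P j, ∑ x'' : Site P j, η ^ (3 * P.d) * ∑ μ : Fin P.d,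
        g x * A ⟨x, μ⟩ * ⟪φ' x, (∑ x' : Site P j, Γ μ x x' x'') (holderLeg η α φ'' x x'')⟫ := by
  unfold ampH3R
  simp only [(locA hn α).2.2.1, (locA hn α).2.2.2.1]
  show ∑ xs : Fin 3 → Site P j, η ^ (3 * P.d) * ∑ μ : Fin P.d,
      g (xs 0) * A ⟨xs 0, μ⟩ * ⟪φ' (xs 0), Γ μ (xs 0) (xs 1) (xs 2) (holderLeg η α φ'' (xs 0) (xs 2))⟫ = _
  rw [sum_arrow_fin_three]
  refine Finset.sum_congr rfl fun x _ => ?_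
  rw [Finset.sum_comm]
  refine Finset.sum_congr rfl fun x'' _ => ?_
  rw [← Finset.mul_sum, Finset.sum_comm]
  congr 1
  refine Finset.sum_congr rfl fun μ _ => ?_
  rw [LinearMap.sum_apply, inner_sum, Finset.mul_sum]
  rfl

/-- **[intermediate term] = [B3] + [B4] through the dictionary**: for a kernel of graph a with the (1.8) structure at BL, the
leg-5-decorated term with leg 4 at T equals the same picture with the ✱→ kernel plus the same picture with the ✱ kernel — the two
✱-pictures of (3.35). [cite: Balaban1983Higgs3, (3.35) p.443] -/
theorem ibp_BL (η α c : ℝ) (K : Fin P.d → Site P j → SiteField P j (W →ₗ[ℝ] W)) (g₁ : SiteField P j ℝ)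
    (M : Fin P.d → Fin P.d → Site P j → Site P j → Site P j → (W →ₗ[ℝ] W)) (g : SiteField P j ℝ) (A : VecField P j ℝ)
    (φ' φ'' : SiteField P j W) :
    ampH3R (picB34pre hn α) (0 : Fin 3) leg4 η (kernel3V (kerBL c K g₁ M)) g A φ' φ'' =
      ampH3R (picB3 hn α).toHolderPicture (0 : Fin 3) leg4 η (kernel3V (kerStarVec c K g₁ M)) g A φ' φ'' +
        ampH3R (picB4 hn α).toHolderPicture (0 : Fin 3) leg4 η (kernel3V (kerStarLoc c K g₁ M)) g A φ' φ'' := by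
  show ampH3R (picB34pre hn α) (0 : Fin 3) leg4 η (kernel3V (kerBL c K g₁ M)) g A φ' φ'' =
    ampH3R (picB34pre hn α) (0 : Fin 3) leg4 η (kernel3V (kerStarVec c K g₁ M)) g A φ' φ'' +
      ampH3R (picB34pre hn α) (0 : Fin 3) leg4 η (kernel3V (kerStarLoc c K g₁ M)) g A φ' φ''
  rw [ampH3R_B34pre, ampH3R_B34pre, ampH3R_B34pre, ← Finset.sum_add_distrib]
  refine Finset.sum_congr rfl fun x _ => ?_
  rw [← Finset.sum_add_distrib]
  refine Finset.sum_congr rfl fun x'' _ => ?_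
  rw [← mul_add, ← Finset.sum_add_distrib]
  congr 1
  refine Finset.sum_congr rfl fun μ _ => ?_
  rw [← mul_add, ← inner_add_right, ← LinearMap.add_apply, ← sum_kerBL]

/-! ### (3.35) assembled -/

/-- **(3.35) through the dictionary, PROVED**: for the graph a with a kernel of the (1.8) structure at BL and the graph b with any
kernel, [a] + [b] = [R1] + [R2] + [B1 + B2 + B3 + B4 + B5] at the level of expressions on the torus (η > 0, any real α, c).
[cite: Balaban1983Higgs3, (3.35) p.443] -/
theorem eq335 (η α c : ℝ) (hη : 0 < η) (K : Fin P.d → Site P j → SiteField P j (W →ₗ[ℝ] W)) (g₁ : SiteField P j ℝ)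
    (M : Fin P.d → Fin P.d → Site P j → Site P j → Site P j → (W →ₗ[ℝ] W)) (Γb : Kernel3 P j W)
    (g : SiteField P j ℝ) (A : VecField P j ℝ) (φ' φ'' : SiteField P j W) :
    amp3 (picA hn) (0 : Fin 3) leg4 leg5 η (kernel3V (kerBL c K g₁ M)) g A φ' φ'' +
        amp3 (picB hn) (0 : Fin 3) leg4 leg5 η (kernel3V Γb) g A φ' φ'' =
      amp3 (picR1 hn) (0 : Fin 3) leg4 leg5 η (kernel3V (kerBL c K g₁ M)) g A φ' φ'' +
        amp3 (picR2 hn) (0 : Fin 3) leg4 leg5 η (kernel3V Γb) g A φ' φ'' +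
      (ampH3L (picB1 hn α) (0 : Fin 3) leg5 η (kernel3V (kerBL c K g₁ M)) g A φ' φ'' +
        ampH3L (picB2 hn α) (0 : Fin 3) leg5 η (kernel3V Γb) g A φ' φ'' +
        ampH3R (picB3 hn α).toHolderPicture (0 : Fin 3) leg4 η (kernel3V (kerStarVec c K g₁ M)) g A φ' φ'' +
        ampH3R (picB4 hn α).toHolderPicture (0 : Fin 3) leg4 η (kernel3V (kerStarLoc c K g₁ M)) g A φ' φ'' +
        ampH3R (picB5 hn α) (0 : Fin 3) leg4 η (kernel3V Γb) g A φ' φ'') := by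
  rw [eq335_transport_a hn η α hη, eq335_transport_b hn η α hη, ibp_BL]
  ring

/-- **(3.35)'s left side is (3.33) twice**: [a] + [b] = expr333(Γ_a) + expr333(Γ_b). [cite: Balaban1983Higgs3, (3.33) p.443] -/
theorem lhs335_eq_expr333 (η : ℝ) (Γa Γb : Kernel3 P j W) (g : SiteField P j ℝ) (A : VecField P j ℝ) (φ' φ'' : SiteField P j W) :
    amp3 (picA hn) (0 : Fin 3) leg4 leg5 η (kernel3V Γa) g A φ' φ'' + amp3 (picB hn) (0 : Fin 3) leg4 leg5 η (kernel3V Γb) g A φ' φ'' =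
      expr333 η Γa g A φ' φ'' + expr333 η Γb g A φ' φ'' := by
  rw [amp3_picA, amp3_picB]

end

end Dictionary

end Literature.MathematicalPhysics.QuantumFieldTheory.Balaban1983to89.B3Eq335Pictures
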